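import Summits.ResolutionOfSingularities.ResolutionOfSingularities.Theorems.HilbertSamuelEliminationCampaignW42RidgeConfinementOfDietel
import Summits.ResolutionOfSingularities.ResolutionOfSingularities.Theorems.HilbertSamuelEliminationCampaignW42WtopConfinement
import Literature.AlgebraicGeometry.Resolution.PermissibleBlowupDirectrix
import Literature.RingTheory.HilbertSamuel.DirectrixFieldExtension
import HarnessLib

/-!
# [OURS · L1 W4.2] `RidgeDimMonotone` — hence the full proposed signature `CampaignW42RidgeConfinement p` of the informal crux
# `RidgeConfinement` (stmt-ResolutionOfSingularities-17845) — MODULO CJS Thm. 3.10 (4) ALONE (the line's standard printed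
# binder `CossartJannsenSaito2020_thm_3_10_4`), instead of modulo Dietel's F-54 (campaign s42, cell res-hironaka; `--supports`)

HONEST FRAMING. OURS (slot W4.2, prover res-L1-s42-pv-1, gen 4). The companion `…CampaignW42RidgeConfinementOfDietel`
(p515958) gave `CampaignW42RidgeConfinement p = RidgeConfines p ∧ RidgeDimMonotone p` modulo the THESIS-flagged fact F-54
`Dietel2015_nearPoint_ridge` (Dietel (8.2.7) (ii), sized XL for a discharge by res-lit-4). OBSERVATION proved here: the
monotonicity conjunct «`dim F_{x'}(X') + trdeg(κ(x')/κ(x)) ≤ dim F_x(X)` at near points» is a COROLLARY of the printed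
CJS Thm. 3.10 (4) in its typed `∀ K` form (Hironaka's Thm (1,A); `CossartJannsenSaito2020_thm_3_10_4`, the binder chain w42
already carries in `stub_printedFactsL`) and two tree THEOREMS about the ridge dimension:

* `dim F_x(X) = ē_x(X)` at every point of every locally noetherian scheme (res-type-047's `ridgeDim_eq_geomDirDim`,
  `…CampaignW42WtopConfinement`, on res-lit-4's discharge of Dietel (6.3.5) (ii));
* `dim F(J) = e(J_K)` for EVERY perfect extension `K` of the ground field (`radical_ridgeIdeal_coneIdeal_eq_and_ridgeDim_eq`,
  `RidgePerfectField.lean`) — applied with `K = κ(x')^{alg}`, which is perfect and carries compatible `κ(x)`- and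
  `κ(x')`-algebra structures, so that Thm. 3.10 (4) at this `K` reads `ē_{x'}(X') + δ ≤ e_x(X)_K = dim F_x(X)`.

Results: `ridgeDimDropAt_of_thm_3_10_4` (pointwise, `X` excellent, `D` permissible, `x'` near), `ridgeDimMonotone_of_thm_3_10_4`,
**`campaignW42RidgeConfinement_of_thm_3_10_4 : CossartJannsenSaito2020_thm_3_10_4 → ∀ p, CampaignW42RidgeConfinement p`**.
So F-54's inequality (8.2.7.B) is, on excellent schemes with globally permissible centres, already Hironaka's (1,A) read on
the ridge. NOTHING here is a statement of H. Hironaka's manuscript [Hironaka2017]; the binder is carried BY NAME and nothing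
is asserted about it. AI review is weaker than expert review. References (orientation only): V. Cossart, U. Jannsen,
S. Saito, LNM 2270 (2020), Thm. 3.10 (4), Rem. 18.29 (1); B. Dietel (2015), (6.3.5) (ii), (8.2.7) (ii); H. Hironaka,
J. Math. Kyoto Univ. 7 (1967), Thm (1,A).
-/

noncomputable section

-- single-conjunct summit: the doubled namespace component `ResolutionOfSingularities` is mandated
set_option linter.dupNamespace false

open CategoryTheory AlgebraicGeometry TopologicalSpace IsLocalRing
open Literature.RingTheory.HilbertSamuel Literature.RingTheory.MvPolynomial
open Literature.AlgebraicGeometry.Resolution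

namespace Summit.ResolutionOfSingularities.ResolutionOfSingularities.Theorems

namespace CampaignW42

universe u

/-! ## `e(A)_K ≤ dim F(A)`, with equality for perfect `K` -/

section LocalRing

variable (A : Type u) [CommRing A] [IsLocalRing A] [IsNoetherianRing A]

/-- **`dim F(A) = e(A)_K` for every PERFECT extension `K` of the residue field** (Dietel (6.3.5) (ii) / (6.1.10), tree
`radical_ridgeIdeal_coneIdeal_eq_and_ridgeDim_eq`). [cite: Dietel2015, Lemma (6.3.5) (ii) p. 76; Lemma (6.1.10) p. 72] -/
theorem localRidgeDim_eq_dirDimOver_of_perfectField (K : Type u) [Field K] [Algebra (ResidueField A) K] [PerfectField K] :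
    localRidgeDim A = dirDimOver A K :=
  (radical_ridgeIdeal_coneIdeal_eq_and_ridgeDim_eq (canonicalTangentConeIdeal A)
    (isHomogeneousIdeal_tangentConeIdeal _ _) K).2

/-- **`e(A)_K ≤ dim F(A)` for EVERY extension `K`** (`e_K ≤ e_{K^{alg}} = dim F`). [cite: CossartJannsenSaito2020, Lemma 2.10 (2), Rem. 18.29] -/
theorem dirDimOver_le_localRidgeDim (K : Type u) [Field K] [Algebra (ResidueField A) K] : dirDimOver A K ≤ localRidgeDim A := by
  rw [localRidgeDim_eq_dirDimOver_of_perfectField A (AlgebraicClosure K)]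
  exact dirDimOver_le_dirDimOver A K (AlgebraicClosure K)

end LocalRing

/-! ## The ridge-dimension drop at a near point from CJS Thm. 3.10 (4) -/

section Schemes

variable {X X' : Scheme.{u}} [IsLocallyNoetherian X] [IsLocallyNoetherian X'] {π : X' ⟶ X} {D : X.IdealSheafData}

/-- **`dim F_{x'}(X') + trdeg(κ(x')/κ(x)) ≤ dim F_x(X)` at a near point of a permissible blow-up, modulo CJS Thm. 3.10 (4).**
`X` excellent, `D` permissible, `π` a blow-up along `D`, `N ≥ dim X`, `x'` over `V(D)` near at level `N`: then
`RidgeDimDropAt π x'` — by Thm. 3.10 (4) at `K = κ(x')^{alg}` (`ē_{x'}(X') + δ ≤ e_x(X)_K`), `dim F = ē`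
(`ridgeDim_eq_geomDirDim`) on the left and `e_x(X)_K = dim F_x(X)` (`K` perfect) on the right.
[cite: CossartJannsenSaito2020, Thm. 3.10 (4), Rem. 18.29 (1)] [cite: Dietel2015, Thm. (8.2.7) (ii) p. 105] -/
theorem ridgeDimDropAt_of_thm_3_10_4 (h : CossartJannsenSaito2020_thm_3_10_4.{u}) (hX : Scheme.IsExcellent X)
    (hD : IdealSheafData.IsPermissible D) (hπ : IsBlowup π D) {N : ℕ} (hN : topologicalKrullDim ↥X ≤ (N : WithBot ℕ∞))
    (x' : X') (hx : π.base x' ∈ (D.support : Set X)) (hnear : IsNearPoint π N x') : RidgeDimDropAt π x' := by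
  -- the algebraic closure `K` of `κ(x')`, as a `κ(x)`-algebra through `π`
  let K : Type u := AlgebraicClosure (ResidueField (X'.presheaf.stalk x'))
  letI algK : Algebra (ResidueField (X.presheaf.stalk (π.base x'))) K :=
    ((algebraMap (ResidueField (X'.presheaf.stalk x')) K).comp (π.residueFieldMap x').hom).toAlgebra
  have halg : ∀ a, algebraMap (ResidueField (X.presheaf.stalk (π.base x'))) K a =
      algebraMap (ResidueField (X'.presheaf.stalk x')) K ((π.residueFieldMap x').hom a) := fun _ => rfl
  have h310 := h X X' π D hX hD hπ N hN x' hx hnear K halg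
  -- left: `e_{x'}(X')_K = ē_{x'}(X') = dim F_{x'}(X')`
  have hL : Scheme.dirDimOver X' x' K = Scheme.ridgeDim X' x' := by
    rw [ridgeDim_eq_geomDirDim]; rfl
  -- right: `e_x(X)_K = dim F_x(X)` (`K` perfect)
  have hR : Scheme.dirDimOver X (π.base x') K = Scheme.ridgeDim X (π.base x') :=
    (localRidgeDim_eq_dirDimOver_of_perfectField (X.presheaf.stalk (π.base x')) K).symm
  rw [hL, hR] at h310
  exact h310

/-- **`RidgeDimMonotone p` modulo CJS Thm. 3.10 (4)** (the second conjunct of the proposed signature of stmt-17845):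
reduced separated schemes of finite type over a field are excellent, so `ridgeDimDropAt_of_thm_3_10_4` applies.
[cite: CossartJannsenSaito2020, Thm. 3.10 (4), Rem. 18.29 (1)] -/
theorem ridgeDimMonotone_of_thm_3_10_4 (h : CossartJannsenSaito2020_thm_3_10_4.{u}) (p : ℕ) : RidgeDimMonotone.{u} p := by
  intro k _ _ X _ f _ hft _ _ D hD X' _ π hπ N hN x' hx hnear
  haveI := hft
  have hexc : Scheme.IsExcellent X := Scheme.isExcellent_of_locallyOfFiniteType Stacks07QW_field_holds f
  exact ridgeDimDropAt_of_thm_3_10_4 h hexc hD hπ hN x' hx hnear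

/-- **`CampaignW42RidgeConfinement p` — the full proposed typed signature of stmt-ResolutionOfSingularities-17845 — holds for
every `p` MODULO CJS Thm. 3.10 (4) alone**: the confinement conjunct is the tree theorem `campaignW42RidgeConfines_holds`
(p513085, unconditional) and the monotonicity conjunct is `ridgeDimMonotone_of_thm_3_10_4`. Compare
`campaignW42RidgeConfinement_of_dietel` (modulo F-54). [cite: CossartJannsenSaito2020, Thm. 3.10 (4), Thm. 3.14, Rem. 18.29 (1)]
[cite: Giraud1975, Cor. 2.4] -/
theorem campaignW42RidgeConfinement_of_thm_3_10_4 (h : CossartJannsenSaito2020_thm_3_10_4.{u}) (p : ℕ) :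
    CampaignW42RidgeConfinement.{u} p :=
  ⟨campaignW42RidgeConfines_holds p, ridgeDimMonotone_of_thm_3_10_4 h p⟩

end Schemes

end CampaignW42

end Summit.ResolutionOfSingularities.ResolutionOfSingularities.Theorems

end
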